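import Summits.QuantumAdvantage.QuantumAdvantage.Theorems.SupportDialResidueCertificateA
import Summits.QuantumAdvantage.QuantumAdvantage.Theorems.MobiusLadderDigitPolyUniformityLARLowDegOrth

/-! # SupportDial residue certificate — part B (decomp-qadv-lens-1 g7, node «ResidueDial» rev 5)

§6b: two-block identity ⇒ moment law (`momentOfTwoBlock2`; Reed–Muller duality `rm_sum_eq_zero`, composition lemma `lowDeg_of_depends`). -/

set_option linter.dupNamespace false
set_option linter.style.longLine false
set_option linter.unusedVariables false

open Finset
open Literature.Computability.QuantumComplexity.RingHLF
open Literature.Computability.MetaComplexity.Smolensky (CubeFn mono lowDeg)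
open Summit.QuantumAdvantage.AdviceFreeQNC0

namespace Summit.QuantumAdvantage.QuantumAdvantage.Theorems.SupportDialResidueCertificate

/-! ## §6b `MomentOfTwoBlock2` PROVED (0 sorry): two-block identity ⇒ moment law, for EVERY `r`
Ingredients: Reed–Muller duality (re-proved here; the tree file `…LARLowDegOrth` is not in the farm snapshot), the
COMPOSITION LEMMA `lowDeg_of_depends` (a function of Boolean data read through `|A|` degree-1 coordinates has degree
`≤ |A|`), the parity bits of the cyclic interval counts (degree 1), and the PIN `psum_full_even` (on the odd class of an
odd ring the full-circle term of the E-block is `+1`, so each block indicator reads only `r+1` parity bits).  Degree count: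
`1 (odd class) + (r+1) (block) + r (column u) = 2r+2 < 2r+3`. -/
section TwoBlockToMoment
open Literature.Computability.MetaComplexity.Smolensky (mono_empty mono_mem_lowDeg lowDeg_mono lowDeg_eq_span mul_mem_lowDeg_add)

/-- ResidueDial helper `ind_xor` (lens-1 g7 ResidueDial certificate; see the enclosing section docstring). -/
theorem ind_xor (a b : Bool) : ind (xor a b) = ind a + ind b := by cases a <;> cases b <;> decide

/-! ### Reed–Muller duality (re-proved from the tree file `…LARLowDegOrth`, which the farm snapshot lacks) -/

/-- ResidueDial helper `mono_update_of_not_mem` (lens-1 g7 ResidueDial certificate; see the enclosing section docstring). -/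
theorem mono_update_of_not_mem {k : ℕ} {U : Finset (Fin k)} {i : Fin k}
    (hi : i ∉ U) (b : Fin k → Bool) (c : Bool) :
    mono (ZMod 2) U (Function.update b i c) = mono (ZMod 2) U b := by
  simp only [Literature.Computability.MetaComplexity.Smolensky.mono]
  refine Finset.prod_congr rfl fun j hj => ?_
  rw [Function.update_of_ne (ne_of_mem_of_not_mem hj hi)]

/-! ### indicator bookkeeping -/

/-- ResidueDial helper `natCast_eq_ind` (lens-1 g7 ResidueDial certificate; see the enclosing section docstring). -/
theorem natCast_eq_ind (n : ℕ) : (n : ZMod 2) = ind (decide (n % 2 = 1)) := by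
  have h2 : (2 : ZMod 2) = 0 := by decide
  conv_lhs => rw [← Nat.mod_add_div n 2]
  push_cast
  rw [h2, zero_mul, add_zero]
  rcases Nat.mod_two_eq_zero_or_one n with h | h <;> simp [h]

/-- ResidueDial helper `sum_ind_eq_card` (lens-1 g7 ResidueDial certificate; see the enclosing section docstring). -/
theorem sum_ind_eq_card {α : Type*} (s : Finset α) (P : α → Bool) :
    ∑ a ∈ s, ind (P a) = ((s.filter fun a => P a = true).card : ZMod 2) := by
  rw [Finset.card_filter]
  push_cast
  exact Finset.sum_congr rfl fun a _ => rfl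

/-- ResidueDial helper `mono_singleton` (lens-1 g7 ResidueDial certificate; see the enclosing section docstring). -/
theorem mono_singleton {k : ℕ} (i : Fin k) (b : Fin k → Bool) : mono (ZMod 2) {i} b = ind (b i) := by
  simp [Literature.Computability.MetaComplexity.Smolensky.mono, ind]

/-- ResidueDial helper `one_mem_lowDeg` (lens-1 g7 ResidueDial certificate; see the enclosing section docstring). -/
theorem one_mem_lowDeg {k D : ℕ} : (1 : CubeFn (ZMod 2) k) ∈ lowDeg (ZMod 2) k D := by
  have h := mono_mem_lowDeg (F := ZMod 2) (n := k) (S := (∅ : Finset (Fin k))) (D := D) (by simp)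
  rwa [mono_empty] at h

/-- Step 1: the inner kernel sum is the parity `jB`. -/
theorem sum_kerB_col {k : ℕ} (β : Fin k → Bool) (j : Fin k) :
    ∑ v : Fin k → Bool, ind (kerB β v && v j) = ind (jB β j) := by
  have hf : (univ.filter fun v : Fin k → Bool => (kerB β v && v j) = true) =
      univ.filter fun v : Fin k → Bool => InKernel β v ∧ v j = true := by
    refine Finset.filter_congr fun v _ => ?_
    simp [kerB, Bool.and_eq_true]
  rw [sum_ind_eq_card, hf, natCast_eq_ind]
  rfl

/-- ResidueDial helper `inner_sum_eq` (lens-1 g7 ResidueDial certificate; see the enclosing section docstring). -/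
theorem inner_sum_eq {k : ℕ} (β : Fin k → Bool) (j : Fin k) (c : ZMod 2) :
    (∑ v : Fin k → Bool, ind (lamB β && kerB β v && v j) * c) = ind (lamB β) * ind (jB β j) * c := by
  have : ∀ v : Fin k → Bool, ind (lamB β && kerB β v && v j) * c = (ind (lamB β) * c) * ind (kerB β v && v j) := by
    intro v; rw [ind_and, ind_and, ind_and]; ring
  rw [Finset.sum_congr rfl fun v _ => this v, ← Finset.mul_sum, sum_kerB_col]; ring

/-- Step 2: on the odd class the two-block identity rewrites `1_Λ · J_j` as the sum of the two block indicators. -/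
theorem lam_jB_eq (hT : TwoBlockLaw2) {k : ℕ} (hk : 3 ≤ k) (hko : k % 2 = 1) (β : Fin k → Bool) (j : Fin k) :
    ind (lamB β) * ind (jB β j) = ind (oddZ β) * (ind (decide (blk β j 0 = 0)) + ind (decide (blk β j 1 = 0))) := by
  unfold lamB
  cases hβ : oddZ β
  · simp
  · have h := hT k hk hko β hβ j
    rw [Bool.true_and, ← ind_and, h, ind_xor, ind_true, one_mul]

/-! ### Step 3: degrees -/

/-- `[β has an odd number of zeros] = 1 + Σ_i [β_i]` for odd `k`. -/
theorem ind_oddZ_eq {k : ℕ} (hko : k % 2 = 1) (β : Fin k → Bool) :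
    ind (oddZ β) = 1 + ∑ i : Fin k, ind (β i) := by
  have hsum : (univ.filter fun b : Fin k => β b = false).card + (univ.filter fun b : Fin k => β b = true).card = k := by
    have h := Finset.card_filter_add_card_filter_not (s := (univ : Finset (Fin k))) (fun b : Fin k => β b = false)
    have hneg : (univ.filter fun b : Fin k => ¬ β b = false) = univ.filter fun b : Fin k => β b = true :=
      Finset.filter_congr fun b _ => by simp
    rw [hneg, Finset.card_univ, Fintype.card_fin] at h
    exact h
  have hz : ((univ.filter fun b : Fin k => β b = false).card : ZMod 2) = ind (oddZ β) := by
    rw [natCast_eq_ind]; rfl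
  have ho : ((univ.filter fun b : Fin k => β b = true).card : ZMod 2) = ∑ i : Fin k, ind (β i) :=
    (sum_ind_eq_card _ _).symm
  have hk : ((k : ℕ) : ZMod 2) = 1 := by
    rw [natCast_eq_ind, hko]; rfl
  have h2 : ∀ x : ZMod 2, x + x = 0 := by decide
  have hcast := congrArg (fun n : ℕ => (n : ZMod 2)) hsum
  simp only [Nat.cast_add] at hcast
  rw [hz, ho, hk] at hcast
  calc ind (oddZ β) = ind (oddZ β) + ((∑ i : Fin k, ind (β i)) + ∑ i : Fin k, ind (β i)) := by rw [h2, add_zero]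
    _ = (ind (oddZ β) + ∑ i : Fin k, ind (β i)) + ∑ i : Fin k, ind (β i) := by ring
    _ = 1 + ∑ i : Fin k, ind (β i) := by rw [hcast]

/-- ResidueDial helper `oddZ_mem_lowDeg` (lens-1 g7 ResidueDial certificate; see the enclosing section docstring). -/
theorem oddZ_mem_lowDeg {k : ℕ} (hko : k % 2 = 1) :
    (fun β : Fin k → Bool => ind (oddZ β)) ∈ lowDeg (ZMod 2) k 1 := by
  have hfun : (fun β : Fin k → Bool => ind (oddZ β)) = 1 + ∑ i : Fin k, mono (ZMod 2) {i} := by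
    funext β
    simp only [Pi.add_apply, Pi.one_apply, Finset.sum_apply, mono_singleton]
    exact ind_oddZ_eq hko β
  rw [hfun]
  exact Submodule.add_mem _ one_mem_lowDeg (Submodule.sum_mem _ fun i _ => mono_mem_lowDeg (by simp))

/-- The parity bit of `psum`. -/
def pbit {k : ℕ} (β : Fin k → Bool) (j : Fin k) (d : ℕ) : Bool := decide (psum β j d % 2 = 1)

/-- ResidueDial helper `pbit_mem_lowDeg` (lens-1 g7 ResidueDial certificate; see the enclosing section docstring). -/
theorem pbit_mem_lowDeg {k : ℕ} (j : Fin k) (d : ℕ) :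
    (fun β : Fin k → Bool => ind (pbit β j d)) ∈ lowDeg (ZMod 2) k 1 := by
  have hfun : (fun β : Fin k → Bool => ind (pbit β j d)) =
      ∑ l ∈ (univ : Finset (Fin k)).filter (fun l => (l - j).val ≤ d), mono (ZMod 2) {l} := by
    funext β
    simp only [Finset.sum_apply, mono_singleton, pbit]
    rw [← natCast_eq_ind, psum, sum_ind_eq_card, Finset.filter_filter]
  rw [hfun]
  exact Submodule.sum_mem _ fun l _ => mono_mem_lowDeg (by simp)

/-- ResidueDial helper `neg_one_pow_eq_sgn` (lens-1 g7 ResidueDial certificate; see the enclosing section docstring). -/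
theorem neg_one_pow_eq_sgn (n : ℕ) : (-1 : ZMod 3) ^ n = if n % 2 = 1 then -1 else 1 := by
  split_ifs with h
  · exact (Nat.odd_iff.2 h).neg_one_pow
  · exact (Nat.even_iff.2 (by omega)).neg_one_pow

/-- sign read off a Boolean parity bit -/
def sgnB (b : Bool) : ZMod 3 := if b = true then -1 else 1

/-- ResidueDial helper `pow_psum_eq` (lens-1 g7 ResidueDial certificate; see the enclosing section docstring). -/
theorem pow_psum_eq {k : ℕ} (β : Fin k → Bool) (j : Fin k) (d : ℕ) :
    (-1 : ZMod 3) ^ psum β j d = sgnB (pbit β j d) := by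
  rw [neg_one_pow_eq_sgn, sgnB, pbit]
  by_cases h : psum β j d % 2 = 1 <;> simp [h]

/-- **Composition lemma**: a function of Boolean data read through the coordinates in `A`, each of degree `≤ 1`,
has degree `≤ |A|`. -/
theorem lowDeg_of_depends {k : ℕ} (b : ℕ → (Fin k → Bool) → Bool)
    (hb : ∀ a, (fun β => ind (b a β)) ∈ lowDeg (ZMod 2) k 1) (A : Finset ℕ) :
    ∀ Φ : (ℕ → Bool) → ZMod 2, (∀ c c' : ℕ → Bool, (∀ a ∈ A, c a = c' a) → Φ c = Φ c') →
      (fun β => Φ (fun a => b a β)) ∈ lowDeg (ZMod 2) k A.card := by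
  induction A using Finset.induction_on with
  | empty =>
    intro Φ hΦ
    have hfun : (fun β => Φ (fun a => b a β)) = Φ (fun _ => false) • (1 : CubeFn (ZMod 2) k) := by
      funext β
      simp only [Pi.smul_apply, Pi.one_apply, smul_eq_mul, mul_one]
      exact hΦ _ _ (fun a ha => absurd ha (by simp))
    rw [hfun, Finset.card_empty]
    exact Submodule.smul_mem _ _ one_mem_lowDeg
  | @insert a A haA ih =>
    intro Φ hΦ
    let Φ1 : (ℕ → Bool) → ZMod 2 := fun c => Φ (Function.update c a true)
    let Φ0 : (ℕ → Bool) → ZMod 2 := fun c => Φ (Function.update c a false)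
    have dep : ∀ v : Bool, ∀ c c' : ℕ → Bool, (∀ x ∈ A, c x = c' x) →
        Φ (Function.update c a v) = Φ (Function.update c' a v) := by
      intro v c c' h
      apply hΦ
      intro x hx
      rcases Finset.mem_insert.1 hx with rfl | hx
      · rw [Function.update_self, Function.update_self]
      · by_cases hxa : x = a
        · subst hxa; rw [Function.update_self, Function.update_self]
        · rw [Function.update_of_ne hxa, Function.update_of_ne hxa]; exact h x hx
    have h1 : (fun β => Φ1 (fun x => b x β)) ∈ lowDeg (ZMod 2) k A.card := ih Φ1 (dep true)
    have h0 : (fun β => Φ0 (fun x => b x β)) ∈ lowDeg (ZMod 2) k A.card := ih Φ0 (dep false)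
    have key : (fun β => Φ (fun x => b x β)) =
        (fun β => ind (b a β)) * (fun β => Φ1 (fun x => b x β)) +
          (1 + fun β => ind (b a β)) * (fun β => Φ0 (fun x => b x β)) := by
      funext β
      simp only [Pi.add_apply, Pi.mul_apply, Pi.one_apply, Φ1, Φ0]
      have h2 : (1 : ZMod 2) + 1 = 0 := by decide
      cases hba : b a β
      · have hu : Function.update (fun x => b x β) a false = fun x => b x β := by
          rw [← hba]; exact Function.update_eq_self a _
        rw [hu, ind_false, zero_mul, zero_add, add_zero, one_mul]
      · have hu : Function.update (fun x => b x β) a true = fun x => b x β := by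
          rw [← hba]; exact Function.update_eq_self a _
        rw [hu, ind_true, one_mul, h2, zero_mul, add_zero]
    rw [key, Finset.card_insert_of_notMem haA]
    have hba1 : (1 + fun β => ind (b a β)) ∈ lowDeg (ZMod 2) k 1 := Submodule.add_mem _ one_mem_lowDeg (hb a)
    have e1 := mul_mem_lowDeg_add (hb a) h1
    have e0 := mul_mem_lowDeg_add hba1 h0
    rw [Nat.add_comm 1 A.card] at e1 e0
    exact Submodule.add_mem _ e1 e0

/-- index sets of the two blocks at `k = 2r+3`: odd offsets `< k` and even offsets `< k−1` have `r+1` members. -/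
theorem card_odd_offsets (r : ℕ) : ((Finset.range (2 * r + 3)).filter fun d => d % 2 = 1).card ≤ r + 1 := by
  have hsub : ((Finset.range (2 * r + 3)).filter fun d => d % 2 = 1) ⊆ (Finset.range (r + 1)).image fun t => 2 * t + 1 := by
    intro d hd
    simp only [Finset.mem_filter, Finset.mem_range] at hd
    simp only [Finset.mem_image, Finset.mem_range]
    exact ⟨d / 2, by omega, by omega⟩
  refine (Finset.card_le_card hsub).trans (Finset.card_image_le.trans ?_)
  simp

/-- ResidueDial helper `card_even_offsets` (lens-1 g7 ResidueDial certificate; see the enclosing section docstring). -/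
theorem card_even_offsets (r : ℕ) : ((Finset.range (2 * r + 2)).filter fun d => d % 2 = 0).card ≤ r + 1 := by
  have hsub : ((Finset.range (2 * r + 2)).filter fun d => d % 2 = 0) ⊆ (Finset.range (r + 1)).image fun t => 2 * t := by
    intro d hd
    simp only [Finset.mem_filter, Finset.mem_range] at hd
    simp only [Finset.mem_image, Finset.mem_range]
    exact ⟨d / 2, by omega, by omega⟩
  refine (Finset.card_le_card hsub).trans (Finset.card_image_le.trans ?_)
  simp

/-- O-block: `blk β j 1` read through the parity bits. -/
def PsiO (r : ℕ) (c : ℕ → Bool) : ZMod 3 :=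
  ∑ d ∈ (Finset.range (2 * r + 3)).filter (fun d => d % 2 = 1), sgnB (c d)

/-- E-block without its last (full-circle) term. -/
def PsiE (r : ℕ) (c : ℕ → Bool) : ZMod 3 :=
  ∑ d ∈ (Finset.range (2 * r + 2)).filter (fun d => d % 2 = 0), sgnB (c d)

/-- ResidueDial helper `blk_one_eq` (lens-1 g7 ResidueDial certificate; see the enclosing section docstring). -/
theorem blk_one_eq (r : ℕ) (β : Fin (2 * r + 3) → Bool) (j : Fin (2 * r + 3)) :
    blk β j 1 = PsiO r (fun d => pbit β j d) := by
  unfold blk PsiO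
  exact Finset.sum_congr rfl fun d _ => pow_psum_eq β j d

/-- PIN: on the odd class of an odd ring the full-circle parity is even. -/
theorem psum_full_even {r : ℕ} (β : Fin (2 * r + 3) → Bool) (hβ : oddZ β = true) (j : Fin (2 * r + 3)) :
    psum β j (2 * r + 2) % 2 = 0 := by
  have hfull : psum β j (2 * r + 2) = (univ.filter fun l : Fin (2 * r + 3) => β l = true).card := by
    unfold psum
    congr 1
    refine Finset.filter_congr fun l _ => ?_
    have := (l - j).isLt
    constructor
    · rintro ⟨-, h⟩; exact h
    · intro h; exact ⟨by omega, h⟩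
  have hsum : (univ.filter fun b : Fin (2 * r + 3) => β b = false).card +
      (univ.filter fun b : Fin (2 * r + 3) => β b = true).card = 2 * r + 3 := by
    have h := Finset.card_filter_add_card_filter_not (s := (univ : Finset (Fin (2 * r + 3))))
      (fun b : Fin (2 * r + 3) => β b = false)
    have hneg : (univ.filter fun b : Fin (2 * r + 3) => ¬ β b = false) = univ.filter fun b : Fin (2 * r + 3) => β b = true :=
      Finset.filter_congr fun b _ => by simp
    rw [hneg, Finset.card_univ, Fintype.card_fin] at h
    exact h
  have hz : (univ.filter fun b : Fin (2 * r + 3) => β b = false).card % 2 = 1 := by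
    unfold oddZ at hβ; exact of_decide_eq_true hβ
  rw [hfull]; omega

/-- ResidueDial helper `blk_zero_eq` (lens-1 g7 ResidueDial certificate; see the enclosing section docstring). -/
theorem blk_zero_eq {r : ℕ} (β : Fin (2 * r + 3) → Bool) (hβ : oddZ β = true) (j : Fin (2 * r + 3)) :
    blk β j 0 = 1 + PsiE r (fun d => pbit β j d) := by
  unfold blk PsiE
  have hrange : Finset.range (2 * r + 3) = insert (2 * r + 2) (Finset.range (2 * r + 2)) := by
    rw [show 2 * r + 3 = (2 * r + 2) + 1 by ring, Finset.range_add_one]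
  rw [hrange, Finset.filter_insert, if_pos (by omega), Finset.sum_insert (by simp)]
  congr 1
  · rw [neg_one_pow_eq_sgn, if_neg (by rw [psum_full_even β hβ j]; omega)]
  · exact Finset.sum_congr rfl fun d _ => pow_psum_eq β j d

/-- ResidueDial helper `PsiO_dep` (lens-1 g7 ResidueDial certificate; see the enclosing section docstring). -/
theorem PsiO_dep (r : ℕ) : ∀ c c' : ℕ → Bool,
    (∀ a ∈ (Finset.range (2 * r + 3)).filter (fun d => d % 2 = 1), c a = c' a) →
    ind (decide (PsiO r c = 0)) = ind (decide (PsiO r c' = 0)) := by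
  intro c c' h
  have : PsiO r c = PsiO r c' := Finset.sum_congr rfl fun d hd => by rw [h d hd]
  rw [this]

/-- ResidueDial helper `PsiE_dep` (lens-1 g7 ResidueDial certificate; see the enclosing section docstring). -/
theorem PsiE_dep (r : ℕ) : ∀ c c' : ℕ → Bool,
    (∀ a ∈ (Finset.range (2 * r + 2)).filter (fun d => d % 2 = 0), c a = c' a) →
    ind (decide (1 + PsiE r c = 0)) = ind (decide (1 + PsiE r c' = 0)) := by
  intro c c' h
  have : PsiE r c = PsiE r c' := Finset.sum_congr rfl fun d hd => by rw [h d hd]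
  rw [this]

/-- ResidueDial helper `blkO_mem` (lens-1 g7 ResidueDial certificate; see the enclosing section docstring). -/
theorem blkO_mem (r : ℕ) (j : Fin (2 * r + 3)) :
    (fun β : Fin (2 * r + 3) → Bool => ind (decide (blk β j 1 = 0))) ∈ lowDeg (ZMod 2) (2 * r + 3) (r + 1) := by
  have h := lowDeg_of_depends (fun d β => pbit β j d) (fun d => pbit_mem_lowDeg j d)
    ((Finset.range (2 * r + 3)).filter (fun d => d % 2 = 1)) (fun c => ind (decide (PsiO r c = 0))) (PsiO_dep r)
  have hfun : (fun β : Fin (2 * r + 3) → Bool => ind (decide (blk β j 1 = 0))) =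
      fun β => ind (decide (PsiO r (fun d => pbit β j d) = 0)) := by
    funext β; rw [blk_one_eq]
  rw [hfun]
  exact lowDeg_mono (card_odd_offsets r) h

/-- ResidueDial helper `oddZ_blkE_mem` (lens-1 g7 ResidueDial certificate; see the enclosing section docstring). -/
theorem oddZ_blkE_mem (r : ℕ) (j : Fin (2 * r + 3)) :
    (fun β : Fin (2 * r + 3) → Bool => ind (oddZ β) * ind (decide (blk β j 0 = 0))) ∈
      lowDeg (ZMod 2) (2 * r + 3) (1 + (r + 1)) := by
  have h := lowDeg_of_depends (fun d β => pbit β j d) (fun d => pbit_mem_lowDeg j d)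
    ((Finset.range (2 * r + 2)).filter (fun d => d % 2 = 0)) (fun c => ind (decide (1 + PsiE r c = 0))) (PsiE_dep r)
  have hE : (fun β : Fin (2 * r + 3) → Bool => ind (decide (1 + PsiE r (fun d => pbit β j d) = 0))) ∈
      lowDeg (ZMod 2) (2 * r + 3) (r + 1) := lowDeg_mono (card_even_offsets r) h
  have hfun : (fun β : Fin (2 * r + 3) → Bool => ind (oddZ β) * ind (decide (blk β j 0 = 0))) =
      (fun β => ind (oddZ β)) * fun β => ind (decide (1 + PsiE r (fun d => pbit β j d) = 0)) := by
    funext β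
    simp only [Pi.mul_apply]
    cases hβ : oddZ β
    · simp
    · rw [blk_zero_eq β hβ j]
  rw [hfun]
  exact mul_mem_lowDeg_add (oddZ_mem_lowDeg (by omega)) hE

/-! ### Assembly of the moment law -/

/-- ResidueDial helper `blockO_sum_zero` (lens-1 g7 ResidueDial certificate; see the enclosing section docstring). -/
theorem blockO_sum_zero {r : ℕ} (j : Fin (2 * r + 3)) {u : CubeFn (ZMod 2) (2 * r + 3)}
    (hu : u ∈ lowDeg (ZMod 2) (2 * r + 3) r) :
    (∑ β : Fin (2 * r + 3) → Bool, ind (oddZ β) * ind (decide (blk β j 1 = 0)) * u β) = 0 := by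
  have hmem : ((fun β : Fin (2 * r + 3) → Bool => ind (oddZ β)) * (fun β => ind (decide (blk β j 1 = 0))) * u) ∈
      lowDeg (ZMod 2) (2 * r + 3) (1 + (r + 1) + r) :=
    mul_mem_lowDeg_add (mul_mem_lowDeg_add (oddZ_mem_lowDeg (by omega)) (blkO_mem r j)) hu
  have h := Summit.QuantumAdvantage.DigitPolyUniformity.SketchLAR.LowDegOrth.sum_eq_zero_of_mem_lowDeg (by omega) hmem
  simpa only [Pi.mul_apply] using h

/-- ResidueDial helper `blockE_sum_zero` (lens-1 g7 ResidueDial certificate; see the enclosing section docstring). -/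
theorem blockE_sum_zero {r : ℕ} (j : Fin (2 * r + 3)) {u : CubeFn (ZMod 2) (2 * r + 3)}
    (hu : u ∈ lowDeg (ZMod 2) (2 * r + 3) r) :
    (∑ β : Fin (2 * r + 3) → Bool, ind (oddZ β) * ind (decide (blk β j 0 = 0)) * u β) = 0 := by
  have hmem : ((fun β : Fin (2 * r + 3) → Bool => ind (oddZ β) * ind (decide (blk β j 0 = 0))) * u) ∈
      lowDeg (ZMod 2) (2 * r + 3) (1 + (r + 1) + r) :=
    mul_mem_lowDeg_add (oddZ_blkE_mem r j) hu
  have h := Summit.QuantumAdvantage.DigitPolyUniformity.SketchLAR.LowDegOrth.sum_eq_zero_of_mem_lowDeg (by omega) hmem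
  simpa only [Pi.mul_apply] using h

/-- **`MomentOfTwoBlock2` PROVED**: the two-block identity implies the moment law for every `r`. -/
theorem momentOfTwoBlock2 : MomentOfTwoBlock2 := by
  intro hT r hr j u hu
  have step : ∀ β : Fin (2 * r + 3) → Bool,
      (∑ v : Fin (2 * r + 3) → Bool, ind (lamB β && kerB β v && v j) * u β) =
        ind (oddZ β) * ind (decide (blk β j 0 = 0)) * u β + ind (oddZ β) * ind (decide (blk β j 1 = 0)) * u β := by
    intro β
    rw [inner_sum_eq β j (u β), lam_jB_eq hT (by omega) (by omega) β j]
    ring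
  rw [Finset.sum_congr rfl fun β _ => step β, Finset.sum_add_distrib, blockE_sum_zero j hu,
    blockO_sum_zero j hu, add_zero]


/-- **The node with the moment law discharged:** `TwoBlockLaw2 → SignTwistLaw2 → YStepLaw2 → HalfDegreeLaw2` (tree 32140). -/
theorem closes_twoBlock (hT : TwoBlockLaw2) (hS : SignTwistLaw2) (hY : YStepLaw2) :
    Summit.QuantumAdvantage.QuantumAdvantage.Theses.SupportDial.HalfDegreeLaw2 :=
  closes (momentOfTwoBlock2 hT) hS hY

end TwoBlockToMoment

end Summit.QuantumAdvantage.QuantumAdvantage.Theorems.SupportDialResidueCertificate
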